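import Summits.Ventures.PercRepro.GZSwapA

/-!
# mine-3's Lemma Φ: the closed-cluster flip (p5, gen 14)

mine-3 (proofs/MINE3-MONOTONICITY.md §27, INBOX 5115 (1)): `Φ(S) = S Δ E[Com_c(S̄)]` — flip every edge with
an endpoint in the CLOSED cluster of `c` (the cluster of `c` in the complement of `S`) — has
`Com_c(Φ(S)) = Com_c(S̄)` and is a bijection of the cube, the inverse being the open-cluster flip.

In the tree the open-cluster flip is typer-1's K-swap `kSwap c` (GZSwapA), whose cut lemma
`cluster_compl_kSwap` already says `Com_c((kSwap c S)ᶜ) = Com_c(S)`. So `Φ = kSwapInv c` below is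
`S ↦ (kSwap c Sᶜ)ᶜ`, and Lemma Φ is: `cluster_kSwapInv` (the cluster identity), `kSwap_kSwapInv` /
`kSwapInv_kSwap` (inverse bijections, packaged as `kSwapEquiv`), and the count identity
`card_oneMark_compl_eq`: `#{S : the closed c-cluster holds exactly one mark} = #ac|b + #bc|a`.
-/

namespace PercRepro

open Finset

namespace MultiGraph

section ClusterFlip

variable {V E : Type*} (G : MultiGraph V E)

open Classical in
/-- **The closed-cluster flip** `Φ(S) = S Δ E[Com_c(S̄)]`: every edge with an endpoint in the cluster of
`c` in the complement of `S` is flipped, every other edge is kept. -/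
noncomputable def kSwapInv (c : V) (ω : Config E) : Config E :=
  fun e => if e ∈ G.edgesAt (G.cluster ωᶜ c) then !ω e else ω e

variable {G}

/-- The closed-cluster flip flips the edges at the closed cluster of `c`. -/
theorem kSwapInv_apply_of_mem {c : V} {ω : Config E} {e : E}
    (he : e ∈ G.edgesAt (G.cluster ωᶜ c)) : G.kSwapInv c ω e = !ω e := by
  simp [kSwapInv, he]

/-- The closed-cluster flip keeps the edges away from the closed cluster of `c`. -/
theorem kSwapInv_apply_of_notMem {c : V} {ω : Config E} {e : E}
    (he : e ∉ G.edgesAt (G.cluster ωᶜ c)) : G.kSwapInv c ω e = ω e := by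
  simp [kSwapInv, he]

/-- `Φ(S)` is the complement of the K-swap of the complement: `Φ(S) = (σ₀(S̄))ᶜ`. -/
theorem kSwapInv_eq_compl_kSwap_compl (c : V) (ω : Config E) :
    G.kSwapInv c ω = (G.kSwap c ωᶜ)ᶜ := by
  funext e
  by_cases he : e ∈ G.edgesAt (G.cluster ωᶜ c)
  · rw [kSwapInv_apply_of_mem he, compl_apply_not, G.kSwap_apply_of_mem he, compl_apply_not,
      Bool.not_not]
  · rw [kSwapInv_apply_of_notMem he, compl_apply_not, G.kSwap_apply_of_notMem he, compl_apply_not,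
      Bool.not_not]

/-- **Lemma Φ, the cluster identity**: the open cluster of `c` in `Φ(S)` is the closed cluster of `c`
in `S`: `Com_c(Φ(S)) = Com_c(S̄)`. -/
theorem cluster_kSwapInv (c : V) (ω : Config E) :
    G.cluster (G.kSwapInv c ω) c = G.cluster ωᶜ c := by
  rw [kSwapInv_eq_compl_kSwap_compl]
  exact G.cluster_compl_kSwap c ωᶜ

/-- `c ~ v` in `Φ(S)` iff `c ~ v` in `S̄`. -/
theorem conn_kSwapInv_iff (c v : V) (ω : Config E) :
    G.Conn (G.kSwapInv c ω) c v ↔ G.Conn ωᶜ c v := by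
  rw [← mem_cluster, ← mem_cluster, cluster_kSwapInv]

/-- **Lemma Φ, the inverse (i)**: the open-cluster flip undoes the closed-cluster flip. -/
theorem kSwap_kSwapInv (c : V) (ω : Config E) : G.kSwap c (G.kSwapInv c ω) = ω := by
  funext e
  by_cases he : e ∈ G.edgesAt (G.cluster ωᶜ c)
  · have he' : e ∈ G.edgesAt (G.cluster (G.kSwapInv c ω) c) := by
      rw [cluster_kSwapInv]; exact he
    rw [G.kSwap_apply_of_mem he', kSwapInv_apply_of_mem he, Bool.not_not]
  · have he' : e ∉ G.edgesAt (G.cluster (G.kSwapInv c ω) c) := by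
      rw [cluster_kSwapInv]; exact he
    rw [G.kSwap_apply_of_notMem he', kSwapInv_apply_of_notMem he]

/-- **Lemma Φ, the inverse (ii)**: the closed-cluster flip undoes the open-cluster flip. -/
theorem kSwapInv_kSwap (c : V) (ω : Config E) : G.kSwapInv c (G.kSwap c ω) = ω := by
  funext e
  by_cases he : e ∈ G.edgesAt (G.cluster ω c)
  · have he' : e ∈ G.edgesAt (G.cluster (G.kSwap c ω)ᶜ c) := by
      rw [G.cluster_compl_kSwap]; exact he
    rw [kSwapInv_apply_of_mem he', G.kSwap_apply_of_mem he, Bool.not_not]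
  · have he' : e ∉ G.edgesAt (G.cluster (G.kSwap c ω)ᶜ c) := by
      rw [G.cluster_compl_kSwap]; exact he
    rw [kSwapInv_apply_of_notMem he', G.kSwap_apply_of_notMem he]

variable (G)

/-- **Lemma Φ (the bijection)**: the open-cluster flip `kSwap c` and the closed-cluster flip
`kSwapInv c` are inverse bijections of the cube of configurations. -/
noncomputable def kSwapEquiv (c : V) : Config E ≃ Config E where
  toFun := G.kSwap c
  invFun := G.kSwapInv c
  left_inv := kSwapInv_kSwap c
  right_inv := kSwap_kSwapInv c

variable {G}

open Classical in
/-- **Lemma Φ, the count**: the configurations whose CLOSED `c`-cluster holds exactly one of the marks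
`a, b` are as many as those whose OPEN `c`-cluster does — `#ac|b + #bc|a` (the two cells are
disjoint). -/
theorem card_oneMark_compl_eq [Fintype E] (a b c : V) :
    (univ.filter fun ω : Config E =>
        (G.Conn ωᶜ c a ∧ ¬ G.Conn ωᶜ c b) ∨ (G.Conn ωᶜ c b ∧ ¬ G.Conn ωᶜ c a)).card =
      (univ.filter fun ω : Config E => G.Conn ω c a ∧ ¬ G.Conn ω c b).card +
        (univ.filter fun ω : Config E => G.Conn ω c b ∧ ¬ G.Conn ω c a).card := by
  -- the closed-cluster flip carries the closed condition to the open one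
  have h1 : (univ.filter fun ω : Config E =>
      (G.Conn ωᶜ c a ∧ ¬ G.Conn ωᶜ c b) ∨ (G.Conn ωᶜ c b ∧ ¬ G.Conn ωᶜ c a)).card =
      (univ.filter fun ω : Config E =>
        (G.Conn ω c a ∧ ¬ G.Conn ω c b) ∨ (G.Conn ω c b ∧ ¬ G.Conn ω c a)).card := by
    refine Finset.card_nbij' (G.kSwapInv c) (G.kSwap c) ?_ ?_ ?_ ?_
    · intro ω hω
      simp only [Finset.coe_filter, Finset.mem_univ, true_and, Set.mem_setOf_eq] at hω ⊢
      simpa only [conn_kSwapInv_iff] using hω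
    · intro τ hτ
      simp only [Finset.coe_filter, Finset.mem_univ, true_and, Set.mem_setOf_eq] at hτ ⊢
      rw [← conn_kSwapInv_iff c a (G.kSwap c τ), ← conn_kSwapInv_iff c b (G.kSwap c τ),
        kSwapInv_kSwap]
      exact hτ
    · intro ω _
      exact kSwap_kSwapInv c ω
    · intro τ _
      exact kSwapInv_kSwap c τ
  rw [h1, Finset.filter_or, Finset.card_union_of_disjoint]
  rw [Finset.disjoint_filter]
  intro ω _ h1 h2
  exact h1.2 h2.1

end ClusterFlip

end MultiGraph

end PercRepro
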